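import Mathlib

/-!
# `SnSubsetDichotomy.GlobalBranch`, line `bregman-entropy-window` — stub `stub_quotientCard`

Registered stub `stub_quotientCard` of crux `stmt-MatrixMultiplication-8303`
(`Summit.MatrixMultiplication.MatrixMultiplication.Theses.SnSubsetDichotomy.GlobalBranch`), line
`bregman-entropy-window`: the quotient set `S⁻¹T = {s⁻¹t : s ∈ S, t ∈ T}` of a pair `(S, T)` of
finite sets of permutations on which `(s,t) ↦ s⁻¹t` is injective (the pairwise part of the triple
product property) has full size `|S⁻¹T| = |S|·|T|`.  This is the counting core of Cohn–Umans 2003,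
proof of Lemma 3.1 (the packing bound `|S||T| ≤ |G|`).

Proof: the hypothesis says precisely that the uncurried map `(s,t) ↦ s⁻¹t` is injective on the
product `S ×ˢ T`, which is `Finset.card_image₂_iff`.
-/

-- `Summit.<Summit>.<Problem>` is the tree's mandated summit-side namespace; for this
-- single-conjunct summit the two coincide, so the file silences `dupNamespace`.
set_option linter.dupNamespace false
set_option autoImplicit false

namespace Summit.MatrixMultiplication.MatrixMultiplication.Theorems.GlobalBranch

/-- **Stub `stub_quotientCard` (quotient sets of a pairwise-injective pair have full size).**
If `S, T ⊆ 𝔖ₙ` are finite sets of permutations such that `s⁻¹t = s'⁻¹t'` with `s, s' ∈ S`,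
`t, t' ∈ T` forces `s = s'` and `t = t'` (the pairwise part of the triple product property), then
the quotient set `S⁻¹T = image₂ (fun s t => s⁻¹ * t) S T` has exactly `|S|·|T|` elements: the
uncurried map `(s,t) ↦ s⁻¹t` is injective on `S ×ˢ T` (`Finset.card_image₂_iff`).  This is the
counting step in Cohn–Umans' packing bound `|S||T| ≤ |G|` for TPP triples.
[cite: CohnUmans2003, Lemma 3.1] -/
theorem stub_quotientCard : ∀ (n : ℕ) (S T : Finset (Equiv.Perm (Fin n))),
    (∀ s ∈ S, ∀ s' ∈ S, ∀ t ∈ T, ∀ t' ∈ T, s⁻¹ * t = s'⁻¹ * t' → s = s' ∧ t = t') →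
      (Finset.image₂ (fun s t => s⁻¹ * t) S T).card = S.card * T.card := by
  intro n S T hinj
  rw [Finset.card_image₂_iff]
  rintro ⟨s, t⟩ hst ⟨s', t'⟩ hst' h
  simp only [Set.mem_prod, Finset.mem_coe] at hst hst'
  obtain ⟨rfl, rfl⟩ := hinj s hst.1 s' hst'.1 t hst.2 t' hst'.2 h
  rfl

end Summit.MatrixMultiplication.MatrixMultiplication.Theorems.GlobalBranch
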